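/-
Origin: expansion seat `planner-pub-hodgecm-prl1-g11-0`, handover #2 2026-08-18T19:19:17Z md5 65a4a1915c67bb299dc8d3bdbfa36c8a (E3 = E2″ + FIX-1 level-meeting end states; NEW additive KERNEL leaf, 711 l.; imports HodgeCM.Model.EndStatePerLAxioms (#1) ONLY — install AFTER #1; NO import rewrite, nothing imports it; lake env lean vs PKG r31 by concatenation after #1 (work/E3Test.lean): rc 0, 0 errors, 0 warnings, 0 proof holes; #print axioms trio on HodgeCM.Assembl (`HOME/pub-hodgecm-prl1-g11/lean/EndStateLevelMeet.lean`, md5 65a4a191, 711 lines);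
landed by the packager successor (mc-unitary-1-g3, gen-8 kit) in gate run 32 as `HodgeCM/Model/EndStateLevelMeet.lean` (verbatim).
-/
/-
Origin: KEPT seat "PerL residual" / END-STATE owner, session `planner-pub-hodgecm-prl1-g11-0` (unit pub-hodgecm-prl1-g11),
2026-08-18.  STAGED as `HOME/pub-hodgecm-prl1-g11/lean/EndStateLevelMeet.lean`; intended final place (packager's call):
`HodgeCM/Model/EndStateLevelMeet.lean`, to be installed AFTER `HodgeCM/Model/EndStatePerLAxioms.lean` (E2′, md5
5e4b37d80c3c…), its only import.  ADDITIVE LEAF: no existing declaration touched, no new hypothesis of any kind — every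
statement below is kernel-proved from the package (`#print axioms` = `[propext, Classical.choice, Quot.sound]` throughout).
-/
import Summits.HodgeConjecture.HodgeCM.Model.EndStatePerLAxioms_2

/-!
# E3 — the END STATE with the level-tower binder `Fact_embCover` replaced by LEVEL-MEETING

Staged by the END-STATE owner (seat prl1, gen 11) as an ADDITIVE leaf over `HodgeCM.Model.EndStatePerLAxioms` (E2′);
nothing imports it.  No new cited facts; every statement below is kernel-proved from the package.

## Why (hazard C1, BINDER-TRIAGE.md §11: FIX 1 adopted 2026-08-18)

The PRINT-labelled binder `ThetaModel.Fact_embCover` (`Automorphic/ThetaFacts.lean:109`: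
`emb Γ' (cover^* η) = emb Γ η` in `L²([G_U])` for `Γ' ≤ Γ`) is FALSE for the geometric (Matsushima / adelic)
embedding of the intended model: a form on ONE connected component `P_Γ` gives a function supported on the principal
`K_Γ`-piece of `[G_U]`, and the principal `K_{Γ'}`-piece is a proper sub-piece as soon as the component count
`r(K_Γ, K_{Γ'}) > 1` (seat mc-autform-2, memo `notes/D1-embCover-typing.md`; tree `LevelOrbitSubpiecesMeasure`:
restriction `coeFn_pieceLiftLp_levelCover`, spread `pieceLiftLp_eq_sum_translate`).  No published theorem states the
tower identity either (carver model2-g2, §11).  So the END STATE of record (E2 = `Assembly.perL_ofSignRecipe₇`, E2′ =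
`perL_ofSignRecipe₇'`) carries one hypothesis the model cannot discharge AS TYPED.

## What this file does

`Fact_embCover` is consumed in exactly one place: it builds the realisation field `ThetaRealisation.Λ_cover`, whose
ONLY use (with `cover`, `level_inf`) is the "pass to a common level" move of PerL v5 tex ll. 375–378 inside the proof
of Thm 4.4 (`PerL34/N20.lean:84–103` = `ModelAxiomsPerL.thm44_of_realisation` Step 4).  This file replaces the three
realisation fields by the ONE statement that move delivers — **level-meeting** (`ThetaRealisation₁.Λ_meet`):

  if the wedge-functions `Λ_{Γ₁}(ω₁,ω₂)` and `Λ_{Γ₂}(ω₃,ω₄)` of classes `ωᵢ ∈ U_{Ψᵢ}` (`ω₁,ω₂` at a level `Γ₁`,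
  `ω₃,ω₄` at a level `Γ₂`) are NOT orthogonal in `L²([G_U])`, then at SOME level `Γ` there are four classes
  `ω'_i ∈ U_{Ψ_i}(Γ)` whose wedge-functions `Λ_Γ(ω'₀,ω'₁)`, `Λ_Γ(ω'₂,ω'₃)` are not orthogonal either —

and the theta-model binder `Fact_embCover` by the corresponding input `ThetaModel.Open_levelMeet` (body
`LevelMeetAt V c`, demanded in good contexts only, like every `Open_` input).  Then it re-derives the whole PerL path:
`thm44_of_realisation₁`, the pointwise construction `nonempty_thetaRealisation₁_at`, `RealisationExistsPerL₁/Face₁`,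
`perL₁`, the seven-input record `ThetaModel.AllCharsNonDesign₁` (= `AllCharsNonDesign` with `embCover ↦ levelMeet`)
and the headline `Assembly.perL_ofSignRecipe₈ (M : U.ModelAxiomsPerL) … (A : ….AllCharsNonDesign₁) … : U.PerL`.

POINTWISE FORMS (J-SAN final = β ≡ ″, carvers model1-g2 19:00:30Z / model2-g2 18:55:57Z, 19:01:39Z): the records
`ThetaModel.AllCharsNonDesignPt S` (E2″: C1 = `EmbCoverAt V`, C2 = `InnerEmbAt V`, the five open inputs — ALL
demanded only at good contexts `c` of the class `S` and at the hermitian space `V` at hand) and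
`ThetaModel.AllCharsNonDesignPt₁ S` (the same with C1 = level-meeting), the PerL path from them WITHOUT a `chars`
input (`nonempty_thetaRealisation₁_at_allChars`, `realisationExistsPerL₁_of_pt`, `perL_of_pt₁`, `perL_of_pt`), the
typed hypotheses `ThetaModelExistsPt₁ S` / `ThetaModelExists_sextic₁`, and the headlines
`Assembly.perL_ofSignRecipe₉ (M : U.ModelAxiomsPerL) (h) (C) (d12 d34) (hS : sextic ⊆ S)
(A : (C.thetaModel h d12 d34).AllCharsNonDesignPt₁ S) (hHR) : U.PerL` — THE term the E seat instantiates for the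
geometric model (nothing is demanded off-regime, nothing at a `V` other than the one at hand) — and
`perL_ofSignRecipe₇''` (E2″ literally), `perL_of_thetaModelExists_sextic₁`.

MONOTONICITY (nothing is lost): `embCover ⟹ levelMeet` over `Fact_pull_comp`, `Fact_pull_cup`
(`ThetaModel.levelMeetAt_of_embCover`, = the old Step 4 verbatim), `ThetaRealisation.toMeet`,
`AllCharsNonDesign.toLevelMeet`, `AllCharsNonDesignPt.toLevelMeet`, restrictions `AllCharsNonDesign.pt`,
`AllCharsNonDesign₁.pt`; so E2″ is the case `A.toLevelMeet …` of ₉, ₈ the case `S = ⊤` of ₉, and E2′ (hence E2)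
the case `A.toLevelMeet M.pull_comp M.pull_cup` of ₈ (closing `example`s).

KERNEL FOOTPRINT (tool `work/ConeMA.lean`, outputs `work/checkE3ma5-out.txt`, `checkE3ma28-out.txt`): see the
report `E3-LEVELMEET-prl1.md` §3.

## What the geometric model has to prove instead (roadmap for the instance seat; not used in this file)

`LevelMeetAt` asks `U_Ψ`-membership at the common level and mentions the model only through `emb`; `U_Ψ(Γ)` is
stable under pull-back along ANY morphism `P_{Γ'} → P_Γ` of the universe (`Universe.pullC_mem_Uiso`, from
`Fact_pull_comp` alone) — coverings AND Hecke translates `P_{Γ'} → P_{Γ₂}`, `[z] ↦ [γ⁻¹ z]` (`Γ' ≤ γ Γ₂ γ⁻¹`,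
`γ ∈ U(V)(L⁺)`).  Sketch of the discharge for `emb_Γ` = extension by zero from the principal piece
`𝒫_Γ = G(ℚ)(G(ℝ) × K_Γ)`, `K_Γ := closure of Γ` (so that `G(ℚ) ∩ K_Γ = Γ`; such "saturated" `K` are closed under
finite intersections and under conjugation by rational `γ`): `𝒫_{Γ₁} ∩ 𝒫_{Γ₂}` is a finite union of `K₁ ∩ K₂`-pieces
`G(ℚ)(G(ℝ) × k (K₁ ∩ K₂))`, `k ∈ K₁ ∩ γ K₂`; on a piece with non-zero contribution substitute `g = h k`: by right
`K₁`-invariance of `F₁₂ = emb_{Γ₁}(ω₁ ∪ ω₂)` the contribution is `∫_{𝒫'} conj (F₃₄ (h k)) · F₁₂ h`, over the principal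
piece `𝒫'` of `Γ' := Γ₁ ∩ γ Γ₂ γ⁻¹` (`K_{Γ'} = K₁ ∩ γ K₂ γ⁻¹`); there `F₁₂ = emb_{Γ'}(cover^*(ω₁ ∪ ω₂))` and
`h ↦ F₃₄ (h k)` is `emb_{Γ'}(φ^*(ω₃ ∪ ω₄))`, `φ : P_{Γ'} → P_{Γ₂}` the Hecke translate by `γ` (restriction = tree
`LevelOrbitSubpiecesMeasure.coeFn_pieceLiftLp_levelCover`, translation = `pieceLiftLp_eq_sum_translate`), so the
contribution equals `⟪Λ_{Γ'}(φ^*ω₃, φ^*ω₄), Λ_{Γ'}(cover^*ω₁, cover^*ω₂)⟫` with all four classes in `U_Ψ(Γ')`.  No tower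
identity, no theta-specific input, no new print field (mc-autform-2's memo §3 `Theta_transl` is not needed).
-/

noncomputable section

open scoped TensorProduct InnerProductSpace Matrix

namespace HodgeCM

open Literature.AlgebraicGeometry.Motives (CMType HodgeStructure)
open Literature.AlgebraicGeometry.Motives.HodgeStructure (conj)
open HodgeCM.Prior.Perl34File

namespace Universe

variable (U : Universe)

/-! ## 1. The realisation record with level-meeting in place of `cover` / `Λ_cover` / `level_inf` -/

/-- **Theta realisation data, level-meeting form**: `HodgeCM.Universe.ThetaRealisation` (`Automorphic/Realisation.lean`)
with the three level-change fields `cover`, `Λ_cover`, `level_inf` replaced by the single field `Λ_meet`; every other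
field VERBATIM (same names, same types). -/
structure ThetaRealisation₁ {L : CMField} (ι₁ : L →+* ℂ) (V : HermSpace3 L ι₁)
    (K : CMField) (Ψ : Fin 4 → CMType K) (σ : K →+* ℂ) where
  H : Type
  HG : Type
  CG : Type
  G : Type
  SK : Type
  SigIdx : Type
  SigIdxG : Type
  [i1 : NormedAddCommGroup H] [i2 : InnerProductSpace ℂ H] [i3 : CompleteSpace H]
  [i4 : NormedAddCommGroup HG] [i5 : InnerProductSpace ℂ HG] [i6 : CompleteSpace HG]
  [i7 : NormedAddCommGroup CG] [i8 : NormedSpace ℂ CG]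
  [i9 : Group G] [i10 : TopologicalSpace G] [i11 : TopologicalSpace SK]
  S : Perl34.IsolationSetting H HG CG G SK SigIdx SigIdxG
  Λ : ∀ Γ : Level V, U.CohC (U.pms L ι₁ V Γ) 1 →ₗ[ℂ] U.CohC (U.pms L ι₁ V Γ) 1 →ₗ[ℂ] HG
  Theta : Fin 4 → ∀ Γ : Level V, Set (U.CohC (U.pms L ι₁ V Γ) 1)
  Theta_sub : ∀ (i : Fin 4) (Γ : Level V), Theta i Γ ⊆ U.Uiso Γ K (Ψ i) σ
  lineField : ∃ Γ : Level V, ∃ ω₁ ∈ Theta 0 Γ, ∃ ω₂ ∈ Theta 1 Γ, Λ Γ ω₁ ω₂ ≠ 0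
  gen12 : ∀ (Γ : Level V) (ω₁ ω₂ : U.CohC (U.pms L ι₁ V Γ) 1),
    ω₁ ∈ Theta 0 Γ → ω₂ ∈ Theta 1 Γ → Λ Γ ω₁ ω₂ ∈ S.t12.S12
  real34 : ∀ χ : S.t34.X, S.t34.allowed χ → ∀ Φ : SK,
    S.t34.ϑ χ Φ ∈ (Submodule.span ℂ
      {x : HG | ∃ Γ : Level V, ∃ ω₃ ∈ Theta 2 Γ, ∃ ω₄ ∈ Theta 3 Γ, x = Λ Γ ω₃ ω₄}).topologicalClosure
  /-- **LEVEL-MEETING** (replaces `cover`, `Λ_cover`, `level_inf`): a non-orthogonal pair of wedge-functions of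
  `U_Ψ`-classes of types `(Ψ₀,Ψ₁)` at `Γ₁` and `(Ψ₂,Ψ₃)` at `Γ₂` can be replaced by a non-orthogonal pair of
  wedge-functions of `U_Ψ`-classes at ONE level. -/
  Λ_meet : ∀ (Γ₁ Γ₂ : Level V) (ω₁ ω₂ : U.CohC (U.pms L ι₁ V Γ₁) 1) (ω₃ ω₄ : U.CohC (U.pms L ι₁ V Γ₂) 1),
    ω₁ ∈ U.Uiso Γ₁ K (Ψ 0) σ → ω₂ ∈ U.Uiso Γ₁ K (Ψ 1) σ → ω₃ ∈ U.Uiso Γ₂ K (Ψ 2) σ → ω₄ ∈ U.Uiso Γ₂ K (Ψ 3) σ →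
    ⟪Λ Γ₂ ω₃ ω₄, Λ Γ₁ ω₁ ω₂⟫_ℂ ≠ 0 →
    ∃ (Γ : Level V) (ω : Fin 4 → U.CohC (U.pms L ι₁ V Γ) 1),
      (∀ i, ω i ∈ U.Uiso Γ K (Ψ i) σ) ∧ ⟪Λ Γ (ω 2) (ω 3), Λ Γ (ω 0) (ω 1)⟫_ℂ ≠ 0
  inner_Λ : ∀ Γ : Level V, ∃ c : ℂ, c ≠ 0 ∧ ∀ ω : Fin 4 → U.CohC (U.pms L ι₁ V Γ) 1,
    (∀ i, ω i ∈ U.H10 (U.pms L ι₁ V Γ)) →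
      ⟪Λ Γ (ω 2) (ω 3), Λ Γ (ω 0) (ω 1)⟫_ℂ = c * U.period (U.pms L ι₁ V Γ) ω

attribute [instance] ThetaRealisation₁.i1 ThetaRealisation₁.i2 ThetaRealisation₁.i3 ThetaRealisation₁.i4
  ThetaRealisation₁.i5 ThetaRealisation₁.i6 ThetaRealisation₁.i7 ThetaRealisation₁.i8 ThetaRealisation₁.i9
  ThetaRealisation₁.i10 ThetaRealisation₁.i11

variable {U}

/-- **MONOTONICITY at the realisation level**: the record of record gives the level-meeting record (the proof of
`Λ_meet` is Step 4 of `thm44_of_realisation` = `PerL34/N20.lean:84–103` verbatim; uses `Fact_pull_comp`). -/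
def ThetaRealisation.toMeet (hpc : U.Fact_pull_comp) {L : CMField} {ι₁ : L →+* ℂ} {V : HermSpace3 L ι₁}
    {K : CMField} {Ψ : Fin 4 → CMType K} {σ : K →+* ℂ} (R : U.ThetaRealisation ι₁ V K Ψ σ) :
    U.ThetaRealisation₁ ι₁ V K Ψ σ where
  H := R.H
  HG := R.HG
  CG := R.CG
  G := R.G
  SK := R.SK
  SigIdx := R.SigIdx
  SigIdxG := R.SigIdxG
  S := R.S
  Λ := R.Λ
  Theta := R.Theta
  Theta_sub := R.Theta_sub
  lineField := R.lineField
  gen12 := R.gen12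
  real34 := R.real34
  Λ_meet := by
    intro Γ₁ Γ₂ ω₁ ω₂ ω₃ ω₄ h₁ h₂ h₃ h₄ hne
    obtain ⟨Γ, hΓ₁, hΓ₂⟩ := R.level_inf Γ₁ Γ₂
    let ω : Fin 4 → U.CohC (U.pms L ι₁ V Γ) 1 := fun i => match i with
      | 0 => U.pullC (R.cover Γ₁ Γ hΓ₁) 1 ω₁
      | 1 => U.pullC (R.cover Γ₁ Γ hΓ₁) 1 ω₂
      | 2 => U.pullC (R.cover Γ₂ Γ hΓ₂) 1 ω₃
      | 3 => U.pullC (R.cover Γ₂ Γ hΓ₂) 1 ω₄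
    refine ⟨Γ, ω, ?_, ?_⟩
    · intro i
      match i with
      | 0 => exact Universe.pullC_mem_Uiso hpc _ K (Ψ 0) σ h₁
      | 1 => exact Universe.pullC_mem_Uiso hpc _ K (Ψ 1) σ h₂
      | 2 => exact Universe.pullC_mem_Uiso hpc _ K (Ψ 2) σ h₃
      | 3 => exact Universe.pullC_mem_Uiso hpc _ K (Ψ 3) σ h₄
    · have e12 : R.Λ Γ (ω 0) (ω 1) = R.Λ Γ₁ ω₁ ω₂ := R.Λ_cover Γ₁ Γ hΓ₁ ω₁ ω₂
      have e34 : R.Λ Γ (ω 2) (ω 3) = R.Λ Γ₂ ω₃ ω₄ := R.Λ_cover Γ₂ Γ hΓ₂ ω₃ ω₄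
      rw [e12, e34]
      exact hne
  inner_Λ := R.inner_Λ

namespace ModelAxiomsPerL

/-! ## 2. Thm 4.4 over the level-meeting record -/

/-- **PerL Thm 4.4's conclusion `PeriodNV` from a level-meeting realisation**, over `pull_hodge` only:
`thm44_of_realisation` with Step 4 ("pass to a common level") supplied by the field `Λ_meet`; Steps 1–3, 5, 6 verbatim. -/
theorem thm44_of_realisation₁ (M : U.ModelAxiomsPerL) {L : CMField} {ι₁ : L →+* ℂ}
    {V : HermSpace3 L ι₁} {K : CMField} {Ψ : Fin 4 → CMType K} {σ : K →+* ℂ}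
    (R : U.ThetaRealisation₁ ι₁ V K Ψ σ) : U.PeriodNV ι₁ V K Ψ σ := by
  classical
  -- Step 1: a nonzero (12)-wedge of theta one-forms at some level Γ₁ (Prop 4.3); it lies in S₁₂ = S₃₄
  obtain ⟨Γ₁, ω₁, hω₁, ω₂, hω₂, hv⟩ := R.lineField
  have hvS : R.Λ Γ₁ ω₁ ω₂ ∈ R.S.t34.S12 := by
    rw [← R.S.C2_S12_eq_S34]
    exact R.gen12 Γ₁ ω₁ ω₂ hω₁ hω₂
  -- Step 2: it pairs non-trivially with some generator ϑ₃₄(χ, Φ) of S₃₄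
  rw [R.S.t34.S12_def] at hvS
  obtain ⟨u, ⟨χ, -, Φ, rfl⟩, hχ⟩ :=
    StubTree.exists_inner_ne_zero_of_mem_closure_span (inner_self_ne_zero.mpr hv) hvS
  -- Step 3: that generator lies in the closed span of ALL (34)-wedges of theta one-forms
  obtain ⟨u, ⟨Γ₂, ω₃, hω₃, ω₄, hω₄, rfl⟩, hu⟩ :=
    StubTree.exists_inner_ne_zero_of_mem_closure_span hχ (R.real34 χ (R.S.H_chars34 χ) Φ)
  -- Step 4′: LEVEL-MEETING
  have hu' : ⟪R.Λ Γ₂ ω₃ ω₄, R.Λ Γ₁ ω₁ ω₂⟫_ℂ ≠ 0 := by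
    intro h0
    apply hu
    rw [← inner_conj_symm, h0, map_zero]
  obtain ⟨Γ, ω, hU, hinner⟩ := R.Λ_meet Γ₁ Γ₂ ω₁ ω₂ ω₃ ω₄ (R.Theta_sub 0 Γ₁ hω₁) (R.Theta_sub 1 Γ₁ hω₂)
    (R.Theta_sub 2 Γ₂ hω₃) (R.Theta_sub 3 Γ₂ hω₄) hu'
  -- Step 5: Petersson pairing = period (all four classes are holomorphic one-forms)
  obtain ⟨c, -, hcΛ⟩ := R.inner_Λ Γ
  have hper : U.period (U.pms L ι₁ V Γ) ω ≠ 0 := by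
    have h := hcΛ ω (fun i => Universe.Uiso_le_H10 M.pull_hodge Γ K (Ψ i) σ (hU i))
    intro h0
    rw [h0, mul_zero] at h
    exact hinner h
  -- Step 6: multilinear expansion to pure pullbacks
  exact Universe.periodNV_of_period_ne_zero Γ ω hU hper

end ModelAxiomsPerL

/-! ## 3. The level-meeting input of a theta model -/

namespace ThetaModel

variable (T : U.ThetaModel)

/-- **LEVEL-MEETING AT `(V, c)`** — the body of the input, for the wedge-functions `T.Λ Γ ω ω' = T.emb Γ (ω ∪ ω')`
of `U_Ψ`-classes (`U.Uiso`, types `c.Ψ i` read through `c.σ`); it mentions `T` only through `T.emb` (no `Theta`, no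
`cover`, no torus data). -/
def LevelMeetAt {L : CMField} {ι₁ : L →+* ℂ} (V : HermSpace3 L ι₁) (c : SeesawCtx L) : Prop :=
  ∀ (Γ₁ Γ₂ : Level V) (ω₁ ω₂ : U.CohC (U.pms L ι₁ V Γ₁) 1) (ω₃ ω₄ : U.CohC (U.pms L ι₁ V Γ₂) 1),
    ω₁ ∈ U.Uiso Γ₁ c.K (c.Ψ 0) c.σ → ω₂ ∈ U.Uiso Γ₁ c.K (c.Ψ 1) c.σ →
    ω₃ ∈ U.Uiso Γ₂ c.K (c.Ψ 2) c.σ → ω₄ ∈ U.Uiso Γ₂ c.K (c.Ψ 3) c.σ →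
    ⟪T.Λ Γ₂ ω₃ ω₄, T.Λ Γ₁ ω₁ ω₂⟫_ℂ ≠ 0 →
    ∃ (Γ : Level V) (ω : Fin 4 → U.CohC (U.pms L ι₁ V Γ) 1),
      (∀ i, ω i ∈ U.Uiso Γ c.K (c.Ψ i) c.σ) ∧ ⟪T.Λ Γ (ω 2) (ω 3), T.Λ Γ (ω 0) (ω 1)⟫_ℂ ≠ 0

/-- **OPEN INPUT (KERNEL-dischargeable for the geometric model; replaces the binder `Fact_embCover` on the PerL
path)** — level-meeting in every good context. -/
def Open_levelMeet : Prop :=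
  ∀ {L : CMField} {ι₁ : L →+* ℂ} (V : HermSpace3 L ι₁) (c : SeesawCtx L), T.GoodCtx ι₁ c → T.LevelMeetAt V c

/-- The body of the binder `Fact_embCover` (C1) at ONE hermitian space `V` (the carvers' `Fact_embCoverAt V`,
J-SAN final 2026-08-18). -/
def EmbCoverAt {L : CMField} {ι₁ : L →+* ℂ} (V : HermSpace3 L ι₁) : Prop :=
  ∀ (Γ Γ' : Level V) (h : Γ'.Γ ≤ Γ.Γ) (η : U.CohC (U.pms L ι₁ V Γ) 2),
    T.emb Γ' (U.pullC (T.cover Γ Γ' h) 2 η) = T.emb Γ η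

/-- The body of the binder `Fact_innerEmb` (C2, [BW2000 VII 3.2]) at ONE hermitian space `V` (the carvers'
`Fact_innerEmbAt V`). -/
def InnerEmbAt {L : CMField} {ι₁ : L →+* ℂ} (V : HermSpace3 L ι₁) : Prop :=
  ∀ Γ : Level V, ∃ c : ℂ, c ≠ 0 ∧ ∀ η η' : U.CohC (U.pms L ι₁ V Γ) 2,
    η ∈ (U.hodge (U.pms L ι₁ V Γ) 2).F 2 → η' ∈ (U.hodge (U.pms L ι₁ V Γ) 2).F 2 →
    ⟪T.emb Γ η', T.emb Γ η⟫_ℂ = c * U.trC (U.pms L ι₁ V Γ) 4 (U.cup2C (U.pms L ι₁ V Γ) 2 η (conj η'))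

/-- (Ported verbatim from the HodgeCMPerL package; no docstring in the source.) -/
theorem fact_embCover_iff :
    T.Fact_embCover ↔ ∀ {L : CMField} {ι₁ : L →+* ℂ} (V : HermSpace3 L ι₁), T.EmbCoverAt V :=
  ⟨fun h _ _ _ Γ Γ' hle η => h Γ Γ' hle η, fun h _ _ _ Γ Γ' hle η => h _ Γ Γ' hle η⟩

/-- (Ported verbatim from the HodgeCMPerL package; no docstring in the source.) -/
theorem fact_innerEmb_iff :
    T.Fact_innerEmb ↔ ∀ {L : CMField} {ι₁ : L →+* ℂ} (V : HermSpace3 L ι₁), T.InnerEmbAt V :=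
  ⟨fun h _ _ _ Γ => h Γ, fun h _ _ _ Γ => h _ Γ⟩

/-- **MONOTONICITY at the input level, pointwise**: the body of `Fact_embCover` at `V` gives level-meeting at
`(V, c)` for every `c`, over `Fact_pull_comp` and `Fact_pull_cup` — the common level is the directed refinement
`levelDirected`, the four classes are the pull-backs (old Step 4). -/
theorem levelMeetAt_of_embCover (hpc : U.Fact_pull_comp) (hcup : U.Fact_pull_cup)
    {L : CMField} {ι₁ : L →+* ℂ} (V : HermSpace3 L ι₁) (c : SeesawCtx L) (h₁ : T.EmbCoverAt V) :
    T.LevelMeetAt V c := by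
  intro Γ₁ Γ₂ ω₁ ω₂ ω₃ ω₄ e₁ e₂ e₃ e₄ hne
  obtain ⟨Γ, hΓ₁, hΓ₂⟩ := levelDirected L ι₁ V Γ₁ Γ₂
  let ω : Fin 4 → U.CohC (U.pms L ι₁ V Γ) 1 := fun i => match i with
    | 0 => U.pullC (T.cover Γ₁ Γ hΓ₁) 1 ω₁
    | 1 => U.pullC (T.cover Γ₁ Γ hΓ₁) 1 ω₂
    | 2 => U.pullC (T.cover Γ₂ Γ hΓ₂) 1 ω₃
    | 3 => U.pullC (T.cover Γ₂ Γ hΓ₂) 1 ω₄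
  have hΛ : ∀ (Γ₀ : Level V) (h : Γ.Γ ≤ Γ₀.Γ) (ω ω' : U.CohC (U.pms L ι₁ V Γ₀) 1),
      T.Λ Γ (U.pullC (T.cover Γ₀ Γ h) 1 ω) (U.pullC (T.cover Γ₀ Γ h) 1 ω') = T.Λ Γ₀ ω ω' := by
    intro Γ₀ h ω ω'
    show T.emb Γ (U.cup2C _ 1 (U.pullC (T.cover Γ₀ Γ h) 1 ω) (U.pullC (T.cover Γ₀ Γ h) 1 ω')) =
      T.emb Γ₀ (U.cup2C _ 1 ω ω')
    rw [← pullC_cup2C hcup]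
    exact h₁ Γ₀ Γ h _
  refine ⟨Γ, ω, ?_, ?_⟩
  · intro i
    match i with
    | 0 => exact Universe.pullC_mem_Uiso hpc _ c.K (c.Ψ 0) c.σ e₁
    | 1 => exact Universe.pullC_mem_Uiso hpc _ c.K (c.Ψ 1) c.σ e₂
    | 2 => exact Universe.pullC_mem_Uiso hpc _ c.K (c.Ψ 2) c.σ e₃
    | 3 => exact Universe.pullC_mem_Uiso hpc _ c.K (c.Ψ 3) c.σ e₄
  · have e12 : T.Λ Γ (ω 0) (ω 1) = T.Λ Γ₁ ω₁ ω₂ := hΛ Γ₁ hΓ₁ ω₁ ω₂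
    have e34 : T.Λ Γ (ω 2) (ω 3) = T.Λ Γ₂ ω₃ ω₄ := hΛ Γ₂ hΓ₂ ω₃ ω₄
    rw [e12, e34]
    exact hne

/-- **MONOTONICITY at the input level**: `Fact_embCover ⟹ Open_levelMeet`. -/
theorem open_levelMeet_of_embCover (hpc : U.Fact_pull_comp) (hcup : U.Fact_pull_cup) (hE : T.Fact_embCover) :
    T.Open_levelMeet :=
  fun V c _ => T.levelMeetAt_of_embCover hpc hcup V c (fun Γ Γ' h η => hE Γ Γ' h η)

/-- Level-meeting is insensitive to the characters allowed (`T.allChars` has the same `emb`, `Theta`, good contexts). -/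
theorem allChars_levelMeet_iff : T.allChars.Open_levelMeet ↔ T.Open_levelMeet :=
  ⟨fun h _ ι₁ V c hc => h V c ((T.allChars_goodCtx_iff ι₁ c).mpr hc),
    fun h _ ι₁ V c hc => h V c ((T.allChars_goodCtx_iff ι₁ c).mp hc)⟩

/-- **The SEVEN all-characters inputs, level-meeting form**: `AllCharsNonDesign` (`SignRecipeEndStateAllChars.lean:280`)
with `embCover : T.Fact_embCover` replaced by `levelMeet : T.Open_levelMeet`; the other six VERBATIM. -/
structure AllCharsNonDesign₁ : Prop where
  levelMeet : T.Open_levelMeet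
  innerEmb : T.Fact_innerEmb
  thetaSub : T.Open_thetaSub
  thetaWedge : T.Open_thetaWedge
  thetaGen12All : T.Open_thetaGen12All
  thetaReal34All : T.Open_thetaReal34All
  occ : T.Open_occ

variable {T}

/-- **MONOTONICITY for the seven-input record** (over `Fact_pull_comp`, `Fact_pull_cup`). -/
theorem AllCharsNonDesign.toLevelMeet (hpc : U.Fact_pull_comp) (hcup : U.Fact_pull_cup)
    (A : T.AllCharsNonDesign) : T.AllCharsNonDesign₁ :=
  ⟨T.open_levelMeet_of_embCover hpc hcup A.embCover, A.innerEmb, A.thetaSub, A.thetaWedge, A.thetaGen12All,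
    A.thetaReal34All, A.occ⟩

variable (T)

/-! ### The POINTWISE records (J-SAN final = β ≡ ″, carvers model1-g2 / model2-g2, 2026-08-18): all seven inputs
demanded only at good contexts `c` of a class `S` and at the hermitian space `V` at hand — C1/C2 included (the
records of record, `AllCharsNonDesign` / the carver's `AllCharsNonDesignOn S`, keep C1/C2 global).  Field bodies are
spelled out (they are the bodies of `SignRecipeEndStateAllChars.Open_*All`, `ThetaFacts.Open_thetaSub/…/Open_occ` at
`(V, c)`), so that a producer's term fits by `rfl`. -/

/-- **E2″ record** (carvers' `AllCharsNonDesignOn″`): the seven all-characters inputs, C1 = `EmbCoverAt V` and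
C2 = `InnerEmbAt V` POINTWISE, all gated by `T.GoodCtx ι₁ c ∧ S c`. -/
structure AllCharsNonDesignPt (S : ∀ {L : CMField}, SeesawCtx L → Prop) : Prop where
  embCover : ∀ {L : CMField} {ι₁ : L →+* ℂ} (V : HermSpace3 L ι₁) (c : SeesawCtx L), T.GoodCtx ι₁ c → S c → T.EmbCoverAt V
  innerEmb : ∀ {L : CMField} {ι₁ : L →+* ℂ} (V : HermSpace3 L ι₁) (c : SeesawCtx L), T.GoodCtx ι₁ c → S c → T.InnerEmbAt V
  thetaSub : ∀ {L : CMField} {ι₁ : L →+* ℂ} (V : HermSpace3 L ι₁) (c : SeesawCtx L), T.GoodCtx ι₁ c → S c →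
    ∀ (i : Fin 4) (Γ : Level V), T.Theta V c i Γ ⊆ U.Uiso Γ c.K (c.Ψ i) c.σ
  thetaWedge : ∀ {L : CMField} {ι₁ : L →+* ℂ} (V : HermSpace3 L ι₁) (c : SeesawCtx L), T.GoodCtx ι₁ c → S c →
    ∃ Γ : Level V, ∃ ω₁ ∈ T.Theta V c 0 Γ, ∃ ω₂ ∈ T.Theta V c 1 Γ, U.cup2C (U.pms L ι₁ V Γ) 1 ω₁ ω₂ ≠ 0
  thetaGen12All : ∀ {L : CMField} {ι₁ : L →+* ℂ} (V : HermSpace3 L ι₁) (c : SeesawCtx L), T.GoodCtx ι₁ c → S c →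
    ∀ (Γ : Level V) (ω₁ ω₂ : U.CohC (U.pms L ι₁ V Γ) 1), ω₁ ∈ T.Theta V c 0 Γ → ω₂ ∈ T.Theta V c 1 Γ →
      T.Λ Γ ω₁ ω₂ ∈ (Submodule.span ℂ
        {u : T.HG L ι₁ V | ∃ (χ : (T.t12 V c).X) (Φ : T.SK V c), u = (T.t12 V c).ϑ χ Φ}).topologicalClosure
  thetaReal34All : ∀ {L : CMField} {ι₁ : L →+* ℂ} (V : HermSpace3 L ι₁) (c : SeesawCtx L), T.GoodCtx ι₁ c → S c →
    ∀ (χ : (T.t34 V c).X) (Φ : T.SK V c),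
      (T.t34 V c).ϑ χ Φ ∈ (Submodule.span ℂ (T.wedgeSet V c 2 3)).topologicalClosure
  occ : ∀ {L : CMField} {ι₁ : L →+* ℂ} (V : HermSpace3 L ι₁) (c : SeesawCtx L), T.GoodCtx ι₁ c → S c →
    (∀ (Φ : T.SK V c) (i : T.SigIdx V c),
        (∃ v ∈ (T.core V c).hatσ i, (T.core V c).TΦ Φ v ≠ 0) → (T.t12 V c).wOccurs i) ∧
      (∀ (Φ : T.SK V c) (i : T.SigIdx V c),
        (∃ v ∈ (T.core V c).hatσ i, (T.core V c).TΦ Φ v ≠ 0) → (T.t34 V c).wOccurs i)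

/-- **E3 record, pointwise** — THE input record for the geometric model: `AllCharsNonDesignPt` with C1 replaced by
LEVEL-MEETING at `(V, c)`. -/
structure AllCharsNonDesignPt₁ (S : ∀ {L : CMField}, SeesawCtx L → Prop) : Prop where
  levelMeet : ∀ {L : CMField} {ι₁ : L →+* ℂ} (V : HermSpace3 L ι₁) (c : SeesawCtx L), T.GoodCtx ι₁ c → S c → T.LevelMeetAt V c
  innerEmb : ∀ {L : CMField} {ι₁ : L →+* ℂ} (V : HermSpace3 L ι₁) (c : SeesawCtx L), T.GoodCtx ι₁ c → S c → T.InnerEmbAt V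
  thetaSub : ∀ {L : CMField} {ι₁ : L →+* ℂ} (V : HermSpace3 L ι₁) (c : SeesawCtx L), T.GoodCtx ι₁ c → S c →
    ∀ (i : Fin 4) (Γ : Level V), T.Theta V c i Γ ⊆ U.Uiso Γ c.K (c.Ψ i) c.σ
  thetaWedge : ∀ {L : CMField} {ι₁ : L →+* ℂ} (V : HermSpace3 L ι₁) (c : SeesawCtx L), T.GoodCtx ι₁ c → S c →
    ∃ Γ : Level V, ∃ ω₁ ∈ T.Theta V c 0 Γ, ∃ ω₂ ∈ T.Theta V c 1 Γ, U.cup2C (U.pms L ι₁ V Γ) 1 ω₁ ω₂ ≠ 0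
  thetaGen12All : ∀ {L : CMField} {ι₁ : L →+* ℂ} (V : HermSpace3 L ι₁) (c : SeesawCtx L), T.GoodCtx ι₁ c → S c →
    ∀ (Γ : Level V) (ω₁ ω₂ : U.CohC (U.pms L ι₁ V Γ) 1), ω₁ ∈ T.Theta V c 0 Γ → ω₂ ∈ T.Theta V c 1 Γ →
      T.Λ Γ ω₁ ω₂ ∈ (Submodule.span ℂ
        {u : T.HG L ι₁ V | ∃ (χ : (T.t12 V c).X) (Φ : T.SK V c), u = (T.t12 V c).ϑ χ Φ}).topologicalClosure
  thetaReal34All : ∀ {L : CMField} {ι₁ : L →+* ℂ} (V : HermSpace3 L ι₁) (c : SeesawCtx L), T.GoodCtx ι₁ c → S c →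
    ∀ (χ : (T.t34 V c).X) (Φ : T.SK V c),
      (T.t34 V c).ϑ χ Φ ∈ (Submodule.span ℂ (T.wedgeSet V c 2 3)).topologicalClosure
  occ : ∀ {L : CMField} {ι₁ : L →+* ℂ} (V : HermSpace3 L ι₁) (c : SeesawCtx L), T.GoodCtx ι₁ c → S c →
    (∀ (Φ : T.SK V c) (i : T.SigIdx V c),
        (∃ v ∈ (T.core V c).hatσ i, (T.core V c).TΦ Φ v ≠ 0) → (T.t12 V c).wOccurs i) ∧
      (∀ (Φ : T.SK V c) (i : T.SigIdx V c),
        (∃ v ∈ (T.core V c).hatσ i, (T.core V c).TΦ Φ v ≠ 0) → (T.t34 V c).wOccurs i)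

variable {T}

/-- MONOTONICITY (over `Fact_pull_comp`, `Fact_pull_cup`): the E2″ record gives the pointwise E3 record. -/
theorem AllCharsNonDesignPt.toLevelMeet (hpc : U.Fact_pull_comp) (hcup : U.Fact_pull_cup)
    {S : ∀ {L : CMField}, SeesawCtx L → Prop} (A : T.AllCharsNonDesignPt S) : T.AllCharsNonDesignPt₁ S :=
  ⟨fun V c hc hS => T.levelMeetAt_of_embCover hpc hcup V c (A.embCover V c hc hS), A.innerEmb, A.thetaSub,
    A.thetaWedge, A.thetaGen12All, A.thetaReal34All, A.occ⟩


-- port_pkg: scope closed for this part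
end ThetaModel
end Universe
end HodgeCM
end
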